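import Summits.BirchSwinnertonDyer.BirchSwinnertonDyer.Theorems.ManinLocalTwoThreeEisensteinDepthTwistLipschitz
import Summits.BirchSwinnertonDyer.BirchSwinnertonDyer.Theorems.ManinLocalTwoThreeCongruenceNumberTwistInvariance
import HarnessLib

/-!
# E-desc-52 / P-desc-2 for same-conductor `(−3)`-twist PAIRS OF ELLIPTIC CURVES, and `S^T ⊗ ℤ[ζ₃] ≤ M^G`

Summit `BirchSwinnertonDyer`, sub-problem `BirchSwinnertonDyer`, route `ManinLocalTwoThree`; width seat `bsd-line-manin23-p2`
(gen 9), `--supports` the crux C3 `ManinPrimeToThreeAtNine` (stmt-BirchSwinnertonDyer-22968).  Cell `bsd-f2-manin`, descent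
lens (desc g8 MEMO-desc §25, g10 §27): the census behind E-desc-52 is over same-level `χ₋₃`-twist pairs of OPTIMAL
CURVES; this file turns the newform-level theorems `eisensteinDepthTwistLipschitz_holds` (E-desc-52, p646381) and
`memConwayNortonLatticeAtThree_of_sameLevelTwist` (P-desc-2, p644922) into statements about modular parametrisation data
of twist pairs, and records the comparison `S^T ⊗ ℤ[ζ₃] ≤ M^G` between desc's two lattices at `3`.

PROVED here (sorry-free):

* `f_eq_charTwist_of_isIsogenous_quadraticTwist_negThree` — for data `D, D′` of `W, W′` at a common level `9 ∣ N` with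
  `W′` additive at `3` and `W ⊗ (−3) ∼ W′`: `D′.f = D.f ⊗ (·/3)` (`cuspCoeff_eq_chi_mul_of_twist_pStar`, Knapp 11.67);
* **`mem_conwayNorton_of_isIsogenous_quadraticTwist_negThree`** — then `D.f, D′.f ∈ M^G(N)` (P-desc-2 for curves: `aₙ(D.f) =
  aₙ(W) ∈ ℤ`);
* **`planeIndex_twistPair_of_isIsogenous_quadraticTwist_negThree`** — and the `f`-planes of `M^G(N)` along `D.f`, `D′.f`
  have equal prime-to-`3` index and `(√−3)`-depths differing by at most one (E-desc-52 for curves);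
* `conwayNortonTwistPair` — the same with desc's conductor-level binders (`N_{W′} = N_W`, data at the conductors);
* **`eisensteinSpan_translationStableLatticeAtThree_le`** — `S^T + ζ₃ S^T ≤ M^G` at every level (`t_{1/3} = A₃ + ζ₃ B₃`,
  `ζ₃² = −1 − ζ₃`): the translation-stable `ℤ`-lattice tensored with `ℤ[ζ₃]` is one of the lattices below `M^G`.

Elementary.  BSD is not proved by this; Manin's conjecture is not proved by this; C3 is not closed by this.
-/

set_option autoImplicit false
set_option linter.dupNamespace false

noncomputable section

open scoped MatrixGroups ModularForm
open CongruenceSubgroup WeierstrassCurve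
open Literature.NumberTheory.EllipticCurves Literature.NumberTheory.EllipticCurves.ModularForms
open Summit.BirchSwinnertonDyer.Rank1Residual.ManinAdditive
open Summit.BirchSwinnertonDyer.Rank1Residual.ManinAdditive.RamanujanCut
open Summit.BirchSwinnertonDyer.Rank1Residual.ManinAdditive.ConwayNortonThree

namespace Summit.BirchSwinnertonDyer.BirchSwinnertonDyer.Theorems.ManinLocalTwoThree

variable {N : ℕ} [NeZero N]

/-! ### `S^T ⊗ ℤ[ζ₃] ≤ M^G` -/

/-- **`S^T + ζ₃ S^T ≤ M^G`** (any level): the `ℤ[ζ₃]`-span of the translation-stable lattice is integral-`⊗ ℤ[ζ₃]`,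
`ζ₃`-stable, `w_Q`-stable and `t_{1/3}`-stable (`t_{1/3}(s + ζ₃ s′) = (A₃ s − B₃ s′) + ζ₃ (B₃ s + A₃ s′ − B₃ s′)`), hence
below the largest such lattice. -/
theorem eisensteinSpan_translationStableLatticeAtThree_le :
    eisensteinSpan (translationStableLatticeAtThree N) ≤ conwayNortonLatticeAtThree N := by
  set L := translationStableLatticeAtThree N with hLdef
  have hLS : L ≤ integralCuspForms0 N 2 := translationStableLatticeAtThree_le
  have hLw : ∀ q : ℕ, q.Prime → q ∣ N → ∀ x ∈ L, atkinLehnerInvolutionAt N 2 q x ∈ L := by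
    intro q hq hqN x hx
    have h : L.map ((atkinLehnerInvolutionAt N 2 q).restrictScalars ℤ) ≤ L := by
      rw [hLdef]; unfold translationStableLatticeAtThree
      rw [Submodule.map_le_iff_le_comap]
      exact sSup_le fun M hM => Submodule.map_le_iff_le_comap.mp ((hM.2.1 q hq hqN).trans (le_sSup hM))
    exact h ⟨x, hx, rfl⟩
  have hLA : ∀ x ∈ L, diagonalOperatorAtThree N 2 x ∈ L := by
    intro x hx
    have h : L.map ((diagonalOperatorAtThree N 2).restrictScalars ℤ) ≤ L := by
      rw [hLdef]; unfold translationStableLatticeAtThree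
      rw [Submodule.map_le_iff_le_comap]
      exact sSup_le fun M hM => Submodule.map_le_iff_le_comap.mp (hM.2.2.1.trans (le_sSup hM))
    exact h ⟨x, hx, rfl⟩
  have hLB : ∀ x ∈ L, twistOperatorAtThree N 2 x ∈ L := fun x hx =>
    map_twistOperatorAtThree_translationStableLatticeAtThree_le ⟨x, hx, rfl⟩
  -- elements of `L + ζ₃ L`
  have hmem : ∀ {x : CuspForm (Gamma0 N) 2}, x ∈ eisensteinSpan L ↔ ∃ s ∈ L, ∃ s' ∈ L, x = s + zeta3 • s' := by
    intro x
    constructor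
    · intro hx
      obtain ⟨s, hs, w, hw, hsw⟩ := Submodule.mem_sup.mp hx
      obtain ⟨s', hs', rfl⟩ := Submodule.mem_map.mp hw
      exact ⟨s, hs, s', hs', hsw.symm⟩
    · rintro ⟨s, hs, s', hs', rfl⟩
      exact Submodule.add_mem _ (Submodule.mem_sup_left hs) (Submodule.mem_sup_right ⟨s', hs', rfl⟩)
  have ht1 : ∀ y, thirdTranslate N 2 1 y = diagonalOperatorAtThree N 2 y + zeta3 • twistOperatorAtThree N 2 y := by
    intro y
    simp only [diagonalOperatorAtThree, LinearMap.sub_apply, LinearMap.smul_apply, sub_add_cancel]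
  refine le_conwayNortonLatticeAtThree ?_ ?_ ?_ ?_
  · -- `≤ S ⊗ ℤ[ζ₃]`
    intro x hx
    obtain ⟨s, hs, s', hs', rfl⟩ := hmem.mp hx
    exact Submodule.add_mem _ (Submodule.mem_sup_left (hLS hs)) (Submodule.mem_sup_right ⟨s', hLS hs', rfl⟩)
  · -- `ζ₃`-stable
    rintro _ ⟨x, hx, rfl⟩
    obtain ⟨s, hs, s', hs', rfl⟩ := hmem.mp hx
    refine hmem.mpr ⟨-s', L.neg_mem hs', s - s', L.sub_mem hs hs', ?_⟩
    change zeta3 • (s + zeta3 • s') = -s' + zeta3 • (s - s')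
    rw [smul_add, smul_smul, ← sq, zeta3_sq, sub_smul, neg_smul, one_smul, smul_sub]
    abel
  · -- `w_Q`-stable
    rintro q hq hqN _ ⟨x, hx, rfl⟩
    obtain ⟨s, hs, s', hs', rfl⟩ := hmem.mp hx
    refine hmem.mpr ⟨atkinLehnerInvolutionAt N 2 q s, hLw q hq hqN s hs, atkinLehnerInvolutionAt N 2 q s',
      hLw q hq hqN s' hs', ?_⟩
    change atkinLehnerInvolutionAt N 2 q (s + zeta3 • s') = _
    rw [map_add, map_smul]
  · -- `t_{1/3}`-stable
    rintro _ ⟨x, hx, rfl⟩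
    obtain ⟨s, hs, s', hs', rfl⟩ := hmem.mp hx
    refine hmem.mpr ⟨diagonalOperatorAtThree N 2 s - twistOperatorAtThree N 2 s',
      L.sub_mem (hLA s hs) (hLB s' hs'),
      twistOperatorAtThree N 2 s + diagonalOperatorAtThree N 2 s' - twistOperatorAtThree N 2 s',
      L.sub_mem (L.add_mem (hLB s hs) (hLA s' hs')) (hLB s' hs'), ?_⟩
    change thirdTranslate N 2 1 (s + zeta3 • s') = _
    rw [map_add, map_smul, ht1, ht1, smul_add, smul_smul, ← sq, zeta3_sq]
    module

/-! ### Same-conductor `(−3)`-twist pairs of elliptic curves -/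

/-- **`f_{W′} = f_W ⊗ (·/3)`** for data of `W, W′` at a common level `9 ∣ N`, `W′` additive at `3` (`9 ∣ N_{W′}`), with `W ⊗ (−3) ∼ W′`
(coefficientwise: `aₙ(W′) = (n/3) aₙ(W)`, both `0` for `3 ∣ n`). -/
theorem f_eq_charTwist_of_isIsogenous_quadraticTwist_negThree {W W' : WeierstrassCurve ℚ} [W.IsElliptic]
    [W'.IsElliptic] (D : ModularParametrizationData W N) (D' : ModularParametrizationData W' N) (h9 : 3 ^ 2 ∣ N)
    (h9W' : 9 ∣ W'.conductorNorm ℤ)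
    (hiso : IsIsogenous (W.quadraticTwist ((-3 : ℤ) : ℚ)) W') :
    haveI : Fact (Nat.Prime 3) := ⟨Nat.prime_three⟩
    D'.f = charTwist N dvd_rfl h9 (isQuadratic_quadraticChar_ringHomComp 3) D.f := by
  haveI : Fact (Nat.Prime 3) := ⟨Nat.prime_three⟩
  have hW' : ¬ W'.HasGoodReductionAtPrime 3 ∧ ¬ W'.HasMultiplicativeReductionAtPrime 3 :=
    not_good_and_not_mult_of_sq_dvd_conductorNorm W' (by simpa using h9W')
  have hW'0 : ∀ n : ℕ, 3 ∣ n → W'.LFunction n = 0 := fun n hn =>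
    W'.LFunction_apply_eq_zero_of_not_good_of_not_mult 3 hW'.1 hW'.2 hn
  have hd : (((-1 : ℤ) ^ (3 / 2) * 3 : ℤ) : ℚ) = ((-3 : ℤ) : ℚ) := by norm_num
  haveI : (W.quadraticTwist ((-3 : ℤ) : ℚ)).IsElliptic := W.isElliptic_quadraticTwist (by norm_num)
  have hu : (1 : VariableChange ℚ) • W.quadraticTwist (((-1 : ℤ) ^ (3 / 2) * 3 : ℤ) : ℚ) =
      W.quadraticTwist ((-3 : ℤ) : ℚ) := by rw [one_smul, hd]
  have hLC : (W.quadraticTwist ((-3 : ℤ) : ℚ)).LFunction = W'.LFunction := LFunction_eq_of_isIsogenous_holds _ _ hiso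
  refine eq_of_forall_cuspCoeff_eq_gamma0 fun n => ?_
  rw [cuspCoeff_charTwist (L := N) (hN := dvd_rfl) (hm := h9) (hχ := isQuadratic_quadraticChar_ringHomComp 3)
    (hprim := isPrimitive_quadraticChar_ringHomComp 3 (by norm_num)) (f := D.f) (n := n)]
  exact cuspCoeff_eq_chi_mul_of_twist_pStar (by norm_num) 1 hu hLC hW'0 D D' n

/-- **P-desc-2 for curves**: under the same hypotheses, `D.f ∈ M^G(N)` and `D′.f ∈ M^G(N)` (`aₙ(D.f) = aₙ(W) ∈ ℤ`,
`D′.f = D.f ⊗ (·/3)` is a newform of level `N`). -/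
theorem mem_conwayNorton_of_isIsogenous_quadraticTwist_negThree {W W' : WeierstrassCurve ℚ} [W.IsElliptic]
    [W'.IsElliptic] (D : ModularParametrizationData W N) (D' : ModularParametrizationData W' N) (h9 : 3 ^ 2 ∣ N)
    (h9W' : 9 ∣ W'.conductorNorm ℤ)
    (hiso : IsIsogenous (W.quadraticTwist ((-3 : ℤ) : ℚ)) W') :
    D.f ∈ conwayNortonLatticeAtThree N ∧ D'.f ∈ conwayNortonLatticeAtThree N := by
  haveI : Fact (Nat.Prime 3) := ⟨Nat.prime_three⟩
  have hfg := f_eq_charTwist_of_isIsogenous_quadraticTwist_negThree D D' h9 h9W' hiso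
  have h := memConwayNortonLatticeAtThree_of_sameLevelTwist h9 (isQuadratic_quadraticChar_ringHomComp 3)
    (isPrimitive_quadraticChar_ringHomComp 3 (by norm_num)) D.isNewformOf.1 (hfg ▸ D'.isNewformOf.1)
    (fun n => ⟨W.LFunction n, D.isNewformOf.2 n⟩)
  rw [← hfg] at h
  exact h

/-- **E-desc-52 for curves**: under the same hypotheses the `f`-planes of `M^G(N)` along `D.f` and `D′.f` have equal
prime-to-`3` index and `(√−3)`-adic depths differing by at most one. -/
theorem planeIndex_twistPair_of_isIsogenous_quadraticTwist_negThree {W W' : WeierstrassCurve ℚ} [W.IsElliptic]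
    [W'.IsElliptic] (D : ModularParametrizationData W N) (D' : ModularParametrizationData W' N) (h9 : 3 ^ 2 ∣ N)
    (h9W' : 9 ∣ W'.conductorNorm ℤ)
    (hiso : IsIsogenous (W.quadraticTwist ((-3 : ℤ) : ℚ)) W') :
    planeIndex (conwayNortonLatticeAtThree N) D.f / 3 ^ eisensteinDepth (conwayNortonLatticeAtThree N) D.f =
        planeIndex (conwayNortonLatticeAtThree N) D'.f / 3 ^ eisensteinDepth (conwayNortonLatticeAtThree N) D'.f ∧
      ((eisensteinDepth (conwayNortonLatticeAtThree N) D.f : ℤ) -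
          eisensteinDepth (conwayNortonLatticeAtThree N) D'.f).natAbs ≤ 1 := by
  haveI : Fact (Nat.Prime 3) := ⟨Nat.prime_three⟩
  have hfg := f_eq_charTwist_of_isIsogenous_quadraticTwist_negThree D D' h9 h9W' hiso
  have h := eisensteinDepthTwistLipschitz_holds N h9 _ (isQuadratic_quadraticChar_ringHomComp 3)
    (isPrimitive_quadraticChar_ringHomComp 3 (by norm_num)) D.f D.isNewformOf.1 (hfg ▸ D'.isNewformOf.1)
  rw [← hfg] at h
  exact h

/-- The twist-pair statement at two propositionally equal levels `N' = N` (technical form: the data live in the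
different types `ModularParametrizationData W N`, `ModularParametrizationData W' N'`). -/
theorem conwayNortonTwistPair_of_level_eq {W W' : WeierstrassCurve ℚ} [W.IsElliptic] [W'.IsElliptic]
    {N N' : ℕ} [NeZero N] [NeZero N'] (D : ModularParametrizationData W N) (D' : ModularParametrizationData W' N')
    (hNN' : N' = N) (h9 : 9 ∣ N) (h9W' : 9 ∣ W'.conductorNorm ℤ)
    (hiso : IsIsogenous (W.quadraticTwist ((-3 : ℤ) : ℚ)) W') :
    D.f ∈ conwayNortonLatticeAtThree N ∧ D'.f ∈ conwayNortonLatticeAtThree N' ∧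
      planeIndex (conwayNortonLatticeAtThree N) D.f / 3 ^ eisensteinDepth (conwayNortonLatticeAtThree N) D.f =
          planeIndex (conwayNortonLatticeAtThree N') D'.f / 3 ^ eisensteinDepth (conwayNortonLatticeAtThree N') D'.f ∧
        ((eisensteinDepth (conwayNortonLatticeAtThree N) D.f : ℤ) -
            eisensteinDepth (conwayNortonLatticeAtThree N') D'.f).natAbs ≤ 1 := by
  subst hNN'
  have h9' : 3 ^ 2 ∣ N' := by simpa using h9
  obtain ⟨hf, hg⟩ := mem_conwayNorton_of_isIsogenous_quadraticTwist_negThree D D' h9' h9W' hiso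
  exact ⟨hf, hg, planeIndex_twistPair_of_isIsogenous_quadraticTwist_negThree D D' h9' h9W' hiso⟩

/-- **The twist-pair statement with desc's conductor-level binders** (data at the conductors, `9 ∣ N_W`, `N_{W′} = N_W`,
`W ⊗ (−3) ∼ W′`): both newforms lie in `M^G`, and their planes satisfy E-desc-52 (equal prime-to-`3` index, depths
differing by at most one). -/
theorem conwayNortonTwistPair {W W' : WeierstrassCurve ℚ} [W.IsElliptic] [W'.IsElliptic]
    [NeZero (W.conductorNorm ℤ)] [NeZero (W'.conductorNorm ℤ)]
    (D : ModularParametrizationData W (W.conductorNorm ℤ)) (D' : ModularParametrizationData W' (W'.conductorNorm ℤ))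
    (h9 : 9 ∣ W.conductorNorm ℤ) (hN : W'.conductorNorm ℤ = W.conductorNorm ℤ)
    (hiso : IsIsogenous (W.quadraticTwist ((-3 : ℤ) : ℚ)) W') :
    D.f ∈ conwayNortonLatticeAtThree (W.conductorNorm ℤ) ∧ D'.f ∈ conwayNortonLatticeAtThree (W'.conductorNorm ℤ) ∧
      planeIndex (conwayNortonLatticeAtThree (W.conductorNorm ℤ)) D.f /
            3 ^ eisensteinDepth (conwayNortonLatticeAtThree (W.conductorNorm ℤ)) D.f =
          planeIndex (conwayNortonLatticeAtThree (W'.conductorNorm ℤ)) D'.f /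
            3 ^ eisensteinDepth (conwayNortonLatticeAtThree (W'.conductorNorm ℤ)) D'.f ∧
        ((eisensteinDepth (conwayNortonLatticeAtThree (W.conductorNorm ℤ)) D.f : ℤ) -
            eisensteinDepth (conwayNortonLatticeAtThree (W'.conductorNorm ℤ)) D'.f).natAbs ≤ 1 :=
  conwayNortonTwistPair_of_level_eq D D' hN h9 (by rw [hN]; exact h9) hiso

end Summit.BirchSwinnertonDyer.BirchSwinnertonDyer.Theorems.ManinLocalTwoThree

end
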